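import Summits.Ventures.HodgeRepro2.T6A2WeilSituation

/-!
# T6A2WeilGen — every smooth projective variety of the host has a generic point (`HasGen` is a theorem)

Cell pub-hodge-repro2, Tier 6 (README §10), seat t6-p2 (A2 host side). The binder `hgen : D.HasGens` of
`transferShadowWeil` (`HasGen P := ∃ z : P.X.left, Order.coheight z = 0`, T6A2WeilAlg) is discharged with no
hypothesis: the host's `IsSmoothProjective n X` carries `GeometricallyIrreducible X.hom` (Varieties.lean), the
base `Spec k` of a field is a single point, so `X.left` is an irreducible space (Mathlib
`GeometricallyIrreducible.irreducibleSpace_of_subsingleton`); schemes are quasi-sober, so it has a generic point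
`η` specialising to every point (`genericPoint_specializes`); in the specialisation order of a scheme
(`Scheme.le_iff_specializes : a ≤ b ↔ b ⤳ a`) `η` is therefore maximal, i.e. of coheight `0`
(`Order.coheight_eq_zero`) — a point of codimension `0` in the host's sense (`cycleClass_of_coheight_eq_zero`).
No display is consumed; no `sorry`; standard axioms. §8(d): uses an L-value-free non-vanishing device: NO.
-/

noncomputable section

namespace Summit.Ventures.HodgeRepro2.T6.WeilInst

open HostAPI.Carriers.AlgebraicGeometry.Motives CategoryTheory AlgebraicGeometry

universe u

variable {k : Type u} [Field k]

/-- the base `Spec k` of a field is a single point (`PrimeSpectrum k` is `Unique`) -/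
theorem subsingleton_spec_field : Subsingleton (Spec (CommRingCat.of k)) :=
  inferInstanceAs (Subsingleton (PrimeSpectrum k))

/-- the base `Spec k` of a field is non-empty -/
theorem nonempty_spec_field : Nonempty (Spec (CommRingCat.of k)) :=
  inferInstanceAs (Nonempty (PrimeSpectrum k))

/-- the underlying scheme of a smooth projective variety of the host is an irreducible space (it is
geometrically irreducible over the one-point base `Spec k`) -/
theorem irreducibleSpace_of_isSmoothProjective {n : ℕ} {X : SchemeOver k} (hX : IsSmoothProjective n X) :
    IrreducibleSpace X.left := by
  haveI : GeometricallyIrreducible X.hom := hX.geometricallyIrreducible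
  haveI := subsingleton_spec_field (k := k)
  haveI := nonempty_spec_field (k := k)
  exact GeometricallyIrreducible.irreducibleSpace_of_subsingleton (f := X.hom)

/-- **EVERY SMOOTH PROJECTIVE VARIETY OF THE HOST HAS A GENERIC POINT**: the generic point of the irreducible
space `P.X.left` is maximal for the specialisation order, hence of coheight `0`. -/
theorem hasGen (P : SPVar k) : HasGen P := by
  haveI := irreducibleSpace_of_isSmoothProjective P.smooth
  refine ⟨genericPoint P.X.left, ?_⟩
  rw [Order.coheight_eq_zero]
  intro y _
  exact (Scheme.le_iff_specializes).2 (genericPoint_specializes y)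

/-- the four spaces of an A2 situation have generic points -/
theorem SituationData.hasGens (D : SituationData k) : D.HasGens := fun i => hasGen (D.spaces i)

end Summit.Ventures.HodgeRepro2.T6.WeilInst

end
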